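import Summits.QuantumFields.YangMills.Theorems.BalabanUVNodesN20HellingerEndpointClassWeights
import Summits.QuantumFields.YangMills.Theorems.BalabanUVNodesN20HybridClassLawCharacterisation

/-!
# BalabanUVNodes ∕ node N20 (NE7b) — THE HELLINGER ROAD FROM ENDPOINT LETTERS, CONSUMER-COMPLETE: along `K`, an affinity-defect letter (H) at the key, the
# endpoint-response letters (R′) + (R‑c) and positivity give node U5's DECL target AND the class-law TV letter, hence — by dag-n20-w4's class-law road p609004 —
# K3⁷ v5 stub 2's three hybrid faces `HybridNE7` with NO bad class and ZERO weight budget; (H) itself from a mixture-moment letter, or from two ONE-RUN variances in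
# the displayed regime; NO interpolated ensemble anywhere on the path

Cell `pub-ymgap` (HUMAN RULING D-0062 Track A ∕ director-ym R399 (3a) second-wave width seats), WIDTH SEAT `pub-ymgap-dag-n20-w5` (node n20 = NE7b),
generation g3, CLAIM-1 ∕ INTENT-2 (bus 2026-08-28T08:01:44Z), FILE 2 of 3.  Key item K3⁷ `SpineGivenEndpointR13SepCoPH` (stmt-QuantumFields-20544; skeleton of
record v5 941dddb108cbaacf, stub 2 `stub_expansion13H` — faces `KeyedRelWeight` (N20), `KeyedShellWeight` (N21), `KeyedCoreEdgeHolderD4` (N19′) at the reading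
pinned by `PinnedAtLive`); filed `--kind proof --supports … --as helper`.  COUNT-NEUTRAL.  THEOREMS ONLY (0 `def`, 0 `instance`, 0 `notation`, 0 `sorry`).
ADDITIVE — imports FILE 1b `…N20HellingerEndpointClassWeights` (through it FILE 1a `…N20HellingerEndpointKernel` and dag-n19-w2's `…N19AffinityClassIndexLaws`,
p612301) and dag-n20-w4's `…N20HybridClassLawCharacterisation` (p609004); every cited theorem BY NAME; modifies nothing.

WHY.  idea-3's crux card `Ideas/hellinger-free-energy-road.md` EDITION 2 writes the chain «C⁺ ⟹ stub-2 body: K1 ⟹ summable Hellinger hence TV radius, K1 + K2 ⟹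
Target (`abs_response_le` + `matching_of_derivative_bound`), ⟹ (n20-w4 ★★) ∃ dials `HybridNE7`» in PROSE («Transfer» l.39, «Assembly sketch» l.45); dag-n20-w4 g2's
p612607 `…N20HellingerRoadOfVarianceAndResponse` closed the EDITION-1 chain (s-uniform interpolated variance (V) + class-mean response (R)).  This file closes the
EDITION-2 chain IN THE KERNEL, on the v5 carrier shapes (`T : ℕ → Finset ι`, class weights `A B : ℕ → ℝ → ι → ℝ` positive on the source window `|t| ≤ l₀`, the
E1∕E2 dictionary `Z K t = Σ_T A K t`, `Z (K+1) t = Σ_T B K t`), with `p_{K,t} = A∕Z_A`, `q_{K,t} = B∕Z_B` the two ONE-RUN class laws: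
* §1 [folklore] ONE-KEY ADAPTER ★ `abs_classLawGap_le_sqrt_two_mul_affinityDefect`: every class-law gap is `≤ √(2(1 − Σ√(pq)))` (dag-n19-w2's Le Cam letter
  `abs_classLawGap_le_sqrt_one_sub_affinity_sq` BY NAME and `1 − a² ≤ 2(1 − a)` on `[0,1]`).
* §2 [folklore] ALONG `K`: ★ `classLawTV_of_affinityDefect` — (H) `∀ K t, |t| ≤ l₀ → 1 − Σ_T √(p_{K,t}·q_{K,t}) ≤ η_K` ⇒ p609004's per-set TV hypothesis VERBATIM with
  `ρ_K := √(2η_K)`; ★★ `target_of_endpointResponse` — class weights differentiable in the source on the window with derivative carriers `A', B'`, (R′)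
  `|E_{q_{K,s}}[B'∕B − A'∕A]| ≤ R₁ K` (the first moment, under run B's law, of the source-derivative of the two-run increment), (R‑c) `Σ ½(p+q)(A'∕A − m_{K,s})² ≤ χ`
  (a one-run source susceptibility under the mixture of the two laws, any centring, uniform bound), (H), `Σ R₁ < ∞`, `Σ √η < ∞` ⇒ node U5's
  `Target vol l₀ δ Z` with `δ_K := l₀·(R₁ K + 2√(2η_K)·√χ)∕vol` and constants `c_K := log Z_{K+1}(0) − log Z_K(0)` (FILE 1b `hasDerivAt_log_total_sub_log_total` +
  `abs_response_le` + `matchingModConstants_of_derivative_bound` at each `K`); ★★★ `exists_hybridNE7_of_endpointLetters` — the same letters with `η_K < ½` ⇒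
  `∃ shA shB, HybridNE7 l₀ vol T A B (fun _ _ => ∅) (fun _ => 0) shA shB (K ↦ √(2η_K)) δ` (p609004 `exists_hybridNE7_of_target_of_classLawTV` BY NAME): NO bad class, ZERO
  weight budget, p609004's misfit shells with budget `√(2η) < 1`, core radius `δ`.
* §3 [folklore] THE (H)-SUPPLIERS OF EDITION 2: ★★ `affinityDefect_of_mixtureMoment` ∕ `exists_hybridNE7_of_mixtureMoment_and_response` — (M) `Σ ½(p+q)(h − c_{K,t})² ≤ M_K`
  (`h = log B − log A`, `c_{K,t} = log Z_B − log Z_A`) gives (H) with `η := M∕4` (FILE 1b `one_sub_affinity_classLaw_le_quarter_mixtureMoment`), so `M_K < 2`, `Σ √M_K < ∞`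
  suffice; ★ `affinityDefect_of_oneRunVariances_of_regime` ∕ `exists_hybridNE7_of_oneRunVariances_of_regime` — two ONE-RUN variances `Var_p h + Var_q h ≤ V_K` in the
  DISPLAYED a-priori regime `1 − Σ√(pq) ≤ 1∕16` give (H) with `η := V∕4` (FILE 1b `mixtureMoment_logRatio_le_of_regime`; dag-n19-w4 g5's p614272
  `variance_le_of_analytic_tilt{_sharp}` is the supplier shape of each variance); ★ `affinityDefect_of_wildMass_and_tameMoment` — the card's (V‑a) + (V‑c′) split:
  wild mass `½Σ_W(p+q) ≤ w_K` plus tame mixture moment `≤ M_K` give `η := w + M∕4`.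
READING (located, nothing proposed).  (i) The binding letters of the edition-2 road at a key are exactly (H) [⇐ wild mass + mixture moment, or one-run variances +
regime], (R′) and (R‑c) — each an expectation under ONE run's class law; the consumer needs NO new dial (CRIT-1 g5 Rec. (c)).  (ii) As a proof of v5's
`stub_expansion13H` the road still needs the KEY-READING dial (`kr := wkey`, plan's v6 booking) to type `(∅, 0, shA, shB)` into `(jc := 0, sh)` — dag-n20-w3's
`exists_optShellSplit` ∕ `relWeightBound_crOfRecord₁₃VAt_cutZero` are the typing lemmas; untouched here.  (iii) `η_K < ½` only makes `√(2η_K) < 1` at EVERY `K` (it holds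
eventually from `Σ √η < ∞`); a shifted-`K` edition is immediate and not typed.  (iv) The regime of §3 is an a-priori two-run closeness INPUT (dag-n20-w4 g2, bus
07:54Z (i)); the mixture-moment edition carries no regime.  (v) dag-n20-w4 g2's CLAIM-4 `…N20TiltedVarianceOfMixtureMoment` (bus 2026-08-28T08:16Z) shows
`Var_{μ_s}(h) ≤ 2e^{2Δ}·M` for `s ∈ [0,1]`: INSIDE the regime the M-letter also feeds p612607's s-uniform (V), so the edition-1 and edition-2 roads agree there up to constants;
dag-n19-w4 g5's `…N19VarianceOfAnalyticTiltFamily` (p616152) is the analyticity door to the same (V).  Neither is used here.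

HONEST FRAMING.  [folklore] finite-sum real analysis + by-name transfer through FILE 1a∕1b, p612301 and p609004; (H), (M), (V), the regime, (R′), (R‑c), the
derivative carriers are HYPOTHESES — UNPROVED, the two-run ones ((YG) behind (H)∕(M)∕(V), (R′)) NOT PRINTED for d = 4, produced by nobody; NO estimate of the
programme is proved; nothing of Bałaban's asserted or instantiated (no `Provisos₁₃CoPH` tuple — K0⁷ OPEN); NE7 ∕ NE7b ∕ NE7c NOT PRINTED as two-run statements for
d = 4 and NOT proved; N19 ∕ N20 ∕ N21 NOT discharged; K3⁷ OPEN, v5 STANDS, not claimed; no summit statement is proved by this seat; counts UNMOVED (typed 28∕28 ·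
discharged 5∕27, A 5∕28).  One finite four-torus programme at fixed ε — NOT ℝ⁴, NOT infinite volume, NOT OS, NOT a mass gap, NOT the Clay problem (R4 closes the
conditional finite-𝕋⁴ rung `BalabanLadder.UV` only).  0 `def`; 0 `sorry`; standard axioms; no cite tags.
-/

noncomputable section

namespace Summit.QuantumFields.YangMills.BalabanUVNodes.N20HellingerEndpointRoad

open Finset
open Summit.QuantumFields.BalabanUV.T4Continuum.Spine.NE7 (Target)
open Literature.MathematicalPhysics.QuantumFieldTheory.Balaban1983to89
open T4CauchySum (MatchingModConstants)
open T4MatchingAssembly (HybridNE7)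
open Summit.QuantumFields.YangMills.BalabanUVNodes.N20HybridClassLawCharacterisation (exists_hybridNE7_of_target_of_classLawTV)
open Summit.QuantumFields.YangMills.BalabanUVNodes.N19AffinityClassIndexLaws
  (div_total_nonneg sum_div_total_eq_one affinity_le_one abs_classLawGap_le_sqrt_one_sub_affinity_sq)
open Summit.QuantumFields.YangMills.BalabanUVNodes.N20HellingerEndpointClassWeights
  (one_sub_affinity_classLaw_le_wildMass_add_mixtureMoment one_sub_affinity_classLaw_le_quarter_mixtureMoment
    mixtureMoment_logRatio_le_of_regime hasDerivAt_log_total_sub_log_total abs_response_le matchingModConstants_of_derivative_bound)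

variable {ι : Type*}

/-! ## §1 One key: every class-law gap is at most `√(2·(1 − affinity))` [folklore] -/

section OneKey
variable {T : Finset ι} {A B : ι → ℝ}

/-- [folklore] `√(1 − a²) ≤ √(2·(1 − a))` for every real `a` (`2(1 − a) − (1 − a²) = (1 − a)² ≥ 0`). -/
theorem sqrt_one_sub_sq_le (a : ℝ) : Real.sqrt (1 - a ^ 2) ≤ Real.sqrt (2 * (1 - a)) :=
  Real.sqrt_le_sqrt (by nlinarith [sq_nonneg (1 - a)])

/-- **★ EVERY CLASS-LAW GAP IS AT MOST `√(2·(1 − Σ√(pq)))`** [folklore; Le Cam]: positive class weights `A, B` on `T`, `p = A∕Z_A`, `q = B∕Z_B` ⇒ for every `S ⊆ T`,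
`|Σ_S A∕Σ_T A − Σ_S B∕Σ_T B| ≤ √(2·(1 − Σ_T √(p·q)))` — dag-n19-w2's `abs_classLawGap_le_sqrt_one_sub_affinity_sq` (p612301) BY NAME and `sqrt_one_sub_sq_le`. -/
theorem abs_classLawGap_le_sqrt_two_mul_affinityDefect [DecidableEq ι] (hA : ∀ τ ∈ T, 0 < A τ) (hB : ∀ τ ∈ T, 0 < B τ)
    (hZA : 0 < ∑ τ ∈ T, A τ) (hZB : 0 < ∑ τ ∈ T, B τ) {S : Finset ι} (hS : S ⊆ T) :
    |(∑ τ ∈ S, A τ) / (∑ τ ∈ T, A τ) - (∑ τ ∈ S, B τ) / (∑ τ ∈ T, B τ)|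
      ≤ Real.sqrt (2 * (1 - ∑ τ ∈ T, Real.sqrt ((A τ / ∑ σ ∈ T, A σ) * (B τ / ∑ σ ∈ T, B σ)))) := by
  exact (abs_classLawGap_le_sqrt_one_sub_affinity_sq T (fun τ hτ => (hA τ hτ).le) (fun τ hτ => (hB τ hτ).le) hZA hZB hS).trans
    (sqrt_one_sub_sq_le _)

end OneKey

/-! ## §2 Along `K`: (H) ⇒ the TV letter; (H) + (R′) + (R‑c) ⇒ the Target; all three ⇒ `HybridNE7` with no bad class, through p609004 [folklore] -/

section Road
variable {l₀ vol : ℝ} {T : ℕ → Finset ι} {A B : ℕ → ℝ → ι → ℝ}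

/-- **★ (H) ⇒ THE CLASS-LAW TV LETTER OF p609004, VERBATIM, WITH `ρ_K := √(2η_K)`** [folklore].  Positive class weights on the source window and the affinity-defect
letter (H) `∀ K t, |t| ≤ l₀ → 1 − Σ_T √(p_{K,t}·q_{K,t}) ≤ η_K` ⇒ `∀ K t, |t| ≤ l₀ → ∀ S ⊆ T K, |Σ_S A∕Σ_T A − Σ_S B∕Σ_T B| ≤ √(2η_K)`. -/
theorem classLawTV_of_affinityDefect [DecidableEq ι]
    (hA : ∀ (K : ℕ) (t : ℝ), |t| ≤ l₀ → ∀ τ ∈ T K, 0 < A K t τ) (hB : ∀ (K : ℕ) (t : ℝ), |t| ≤ l₀ → ∀ τ ∈ T K, 0 < B K t τ)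
    (hZA : ∀ (K : ℕ) (t : ℝ), |t| ≤ l₀ → 0 < ∑ τ ∈ T K, A K t τ) (hZB : ∀ (K : ℕ) (t : ℝ), |t| ≤ l₀ → 0 < ∑ τ ∈ T K, B K t τ)
    {η : ℕ → ℝ}
    (hH : ∀ (K : ℕ) (t : ℝ), |t| ≤ l₀ →
      1 - ∑ τ ∈ T K, Real.sqrt ((A K t τ / ∑ σ ∈ T K, A K t σ) * (B K t τ / ∑ σ ∈ T K, B K t σ)) ≤ η K) :
    ∀ (K : ℕ) (t : ℝ), |t| ≤ l₀ → ∀ S ⊆ T K,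
      |(∑ τ ∈ S, A K t τ) / (∑ τ ∈ T K, A K t τ) - (∑ τ ∈ S, B K t τ) / (∑ τ ∈ T K, B K t τ)| ≤ Real.sqrt (2 * η K) := by
  intro K t ht S hS
  refine (abs_classLawGap_le_sqrt_two_mul_affinityDefect (hA K t ht) (hB K t ht) (hZA K t ht) (hZB K t ht) hS).trans ?_
  exact Real.sqrt_le_sqrt (by linarith [hH K t ht])

/-- [bookkeeping] (H) read at `t = 0` makes `η_K ≥ 0` (the affinity of two laws is at most one). -/
theorem eta_nonneg_of_affinityDefect (hl₀ : 0 ≤ l₀)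
    (hA : ∀ (K : ℕ) (t : ℝ), |t| ≤ l₀ → ∀ τ ∈ T K, 0 < A K t τ) (hB : ∀ (K : ℕ) (t : ℝ), |t| ≤ l₀ → ∀ τ ∈ T K, 0 < B K t τ)
    (hZA : ∀ (K : ℕ) (t : ℝ), |t| ≤ l₀ → 0 < ∑ τ ∈ T K, A K t τ) (hZB : ∀ (K : ℕ) (t : ℝ), |t| ≤ l₀ → 0 < ∑ τ ∈ T K, B K t τ)
    {η : ℕ → ℝ}
    (hH : ∀ (K : ℕ) (t : ℝ), |t| ≤ l₀ →
      1 - ∑ τ ∈ T K, Real.sqrt ((A K t τ / ∑ σ ∈ T K, A K t σ) * (B K t τ / ∑ σ ∈ T K, B K t σ)) ≤ η K) (K : ℕ) :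
    0 ≤ η K := by
  have h0 : |(0:ℝ)| ≤ l₀ := by simpa using hl₀
  have h1 := affinity_le_one (T K) (div_total_nonneg (T K) (fun τ hτ => (hA K 0 h0 τ hτ).le) (hZA K 0 h0))
    (div_total_nonneg (T K) (fun τ hτ => (hB K 0 h0 τ hτ).le) (hZB K 0 h0)) (sum_div_total_eq_one (T K) (hZA K 0 h0))
    (sum_div_total_eq_one (T K) (hZB K 0 h0))
  linarith [hH K 0 h0]

/-- **★★ (H) + (R′) + (R‑c) ⇒ NODE U5's DECL TARGET** [folklore].  Positive class weights, DIFFERENTIABLE in the source on the window `|s| ≤ l₀` with derivative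
carriers `A' K s τ`, `B' K s τ`; the E1∕E2 dictionary; (H) the affinity-defect letter with `Σ √η_K < ∞`; (R′) the first moment, under run B's class law, of the
source-derivative of the two-run increment, `|Σ_T q_{K,s}·(B'∕B − A'∕A)| ≤ R₁ K`, `Σ R₁ < ∞`; (R‑c) a one-run source susceptibility under the mixture of the two laws,
`Σ_T ½(p+q)(A'∕A − m_{K,s})² ≤ χ` for some centring `m` ⇒ `Target vol l₀ δ Z` with `δ_K := l₀·(R₁ K + 2·√(2η_K)·√χ)∕vol` and constants
`c_K := log Z_{K+1}(0) − log Z_K(0)`: at each `K`, `c_K(s) = log Z_B − log Z_A` has derivative `Z_B'∕Z_B − Z_A'∕Z_A` (FILE 1b `hasDerivAt_log_total_sub_log_total`), bounded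
by `R₁ K + 2√(2(1 − Σ√(pq)))·√(Σ½(p+q)(j − m)²) ≤ R₁ K + 2√(2η_K)√χ` (FILE 1b `abs_response_le` — the cross term PAID BY (H)), and the mean-value step
(`matchingModConstants_of_derivative_bound`) matches `c_K(t)` to `c_K(0)` within `l₀` times that.  No interpolated ensemble, no width integral. -/
theorem target_of_endpointResponse (hl₀ : 0 ≤ l₀) (hvol : 0 < vol)
    (hA : ∀ (K : ℕ) (t : ℝ), |t| ≤ l₀ → ∀ τ ∈ T K, 0 < A K t τ) (hB : ∀ (K : ℕ) (t : ℝ), |t| ≤ l₀ → ∀ τ ∈ T K, 0 < B K t τ)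
    (hZA : ∀ (K : ℕ) (t : ℝ), |t| ≤ l₀ → 0 < ∑ τ ∈ T K, A K t τ) (hZB : ∀ (K : ℕ) (t : ℝ), |t| ≤ l₀ → 0 < ∑ τ ∈ T K, B K t τ)
    {Z : ℕ → ℝ → ℝ} (hZA' : ∀ (K : ℕ) (t : ℝ), |t| ≤ l₀ → Z K t = ∑ τ ∈ T K, A K t τ)
    (hZB' : ∀ (K : ℕ) (t : ℝ), |t| ≤ l₀ → Z (K + 1) t = ∑ τ ∈ T K, B K t τ)
    {A' B' : ℕ → ℝ → ι → ℝ}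
    (hdA : ∀ (K : ℕ) (s : ℝ), |s| ≤ l₀ → ∀ τ ∈ T K, HasDerivAt (fun u => A K u τ) (A' K s τ) s)
    (hdB : ∀ (K : ℕ) (s : ℝ), |s| ≤ l₀ → ∀ τ ∈ T K, HasDerivAt (fun u => B K u τ) (B' K s τ) s)
    {η R₁ : ℕ → ℝ} {χ : ℝ} {m : ℕ → ℝ → ℝ}
    (hH : ∀ (K : ℕ) (t : ℝ), |t| ≤ l₀ →
      1 - ∑ τ ∈ T K, Real.sqrt ((A K t τ / ∑ σ ∈ T K, A K t σ) * (B K t τ / ∑ σ ∈ T K, B K t σ)) ≤ η K)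
    (hR : ∀ (K : ℕ) (s : ℝ), |s| ≤ l₀ →
      |∑ τ ∈ T K, B K s τ / (∑ σ ∈ T K, B K s σ) * (B' K s τ / B K s τ - A' K s τ / A K s τ)| ≤ R₁ K)
    (hχ : ∀ (K : ℕ) (s : ℝ), |s| ≤ l₀ →
      ∑ τ ∈ T K, (A K s τ / (∑ σ ∈ T K, A K s σ) + B K s τ / (∑ σ ∈ T K, B K s σ)) / 2 * (A' K s τ / A K s τ - m K s) ^ 2 ≤ χ)
    (hηs : Summable fun K => Real.sqrt (η K)) (hRs : Summable R₁) :
    Target vol l₀ (fun K => l₀ * (R₁ K + 2 * Real.sqrt (2 * η K) * Real.sqrt χ) / vol) Z := by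
  have h0 : |(0:ℝ)| ≤ l₀ := by simpa using hl₀
  refine ⟨fun K => ⟨Real.log (Z (K + 1) 0) - Real.log (Z K 0), fun t ht => ?_⟩, ?_⟩
  · -- the target function at level `K` and its derivative bound on the window
    have hder : ∀ s, |s| ≤ l₀ → HasDerivAt (fun u => Real.log (∑ τ ∈ T K, B K u τ) - Real.log (∑ τ ∈ T K, A K u τ))
        ((∑ τ ∈ T K, B' K s τ) / (∑ τ ∈ T K, B K s τ) - (∑ τ ∈ T K, A' K s τ) / (∑ τ ∈ T K, A K s τ)) s :=
      fun s hs => hasDerivAt_log_total_sub_log_total (hdA K s hs) (hdB K s hs) (hZA K s hs).ne' (hZB K s hs).ne'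
    have hbd : ∀ s, |s| ≤ l₀ →
        |(∑ τ ∈ T K, B' K s τ) / (∑ τ ∈ T K, B K s τ) - (∑ τ ∈ T K, A' K s τ) / (∑ τ ∈ T K, A K s τ)|
          ≤ R₁ K + 2 * Real.sqrt (2 * η K) * Real.sqrt χ := by
      intro s hs
      have h1 := abs_response_le (hA K s hs) (hB K s hs) (hZA K s hs) (hZB K s hs) (A' K s) (B' K s) (m K s)
      have h2 : Real.sqrt (2 * (1 - ∑ τ ∈ T K, Real.sqrt ((A K s τ / ∑ σ ∈ T K, A K s σ) * (B K s τ / ∑ σ ∈ T K, B K s σ))))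
          ≤ Real.sqrt (2 * η K) := Real.sqrt_le_sqrt (by linarith [hH K s hs])
      have h3 : Real.sqrt (∑ τ ∈ T K, (A K s τ / (∑ σ ∈ T K, A K s σ) + B K s τ / (∑ σ ∈ T K, B K s σ)) / 2
            * (A' K s τ / A K s τ - m K s) ^ 2) ≤ Real.sqrt χ := Real.sqrt_le_sqrt (hχ K s hs)
      have h4 := mul_le_mul h2 h3 (Real.sqrt_nonneg _) (Real.sqrt_nonneg _)
      linarith [hR K s hs]
    have key := matchingModConstants_of_derivative_bound hl₀ hder hbd t ht
    rw [hZA' K t ht, hZB' K t ht, hZA' K 0 h0, hZB' K 0 h0]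
    have e : vol * (l₀ * (R₁ K + 2 * Real.sqrt (2 * η K) * Real.sqrt χ) / vol)
        = (R₁ K + 2 * Real.sqrt (2 * η K) * Real.sqrt χ) * l₀ := by
      field_simp
    rw [e]
    simpa [sub_sub] using key
  · -- summability of the radius
    have hs2 : Summable fun K => Real.sqrt (2 * η K) := by
      have : (fun K => Real.sqrt (2 * η K)) = fun K => Real.sqrt 2 * Real.sqrt (η K) := by
        funext K; exact Real.sqrt_mul (by norm_num) _
      rw [this]; exact hηs.mul_left _
    have h3 : Summable fun K => R₁ K + 2 * Real.sqrt (2 * η K) * Real.sqrt χ := by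
      have := (hs2.mul_left 2).mul_right (Real.sqrt χ)
      exact hRs.add (by simpa [mul_assoc] using this)
    simpa [mul_div_assoc] using ((h3.mul_left l₀).div_const vol)

/-- **★★★ THE HELLINGER ROAD FROM ENDPOINT LETTERS, KERNEL FORM: STUB 2's THREE HYBRID FACES AT A KEY FROM (H) + (R′) + (R‑c)** [folklore].  Carriers `T K`,
positive class weights differentiable in the source on `|s| ≤ l₀` (`0 ≤ l₀`, `0 < vol`), the E1∕E2 dictionary for `Z`; (H) the affinity defect of the two runs' ONE-RUN
class laws at the key bounded by `η_K < ½` with `Σ_K √η_K < ∞`; (R′) `|E_{q_{K,s}}[∂_s h]| ≤ R₁ K`, `Σ R₁ < ∞`; (R‑c) the mixture second moment of the run-A source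
current `j = A'∕A` about any centring bounded by `χ` ⇒
`∃ shA shB, HybridNE7 l₀ vol T A B (fun _ _ => ∅) (fun _ => 0) shA shB (K ↦ √(2η_K)) (K ↦ l₀·(R₁ K + 2√(2η_K)√χ)∕vol)` — the hybrid binder list (NE7b weight face with NO
bad class and budget `0`, NE7c shells = p609004's misfit shells with budget `√(2η) < 1`, NE7 core edge at the endpoint-response radius, `Σ < ∞` throughout) — by
`target_of_endpointResponse`, `classLawTV_of_affinityDefect` and dag-n20-w4's `exists_hybridNE7_of_target_of_classLawTV` (p609004) BY NAME.  The card's edition-2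
«Transfer» `C⁺ ⟹ stub-2 body` up to the typing of `(∅, 0, shA, shB)` into `(jc := 0, sh)` at a key reading (its K3 ∕ v6). -/
theorem exists_hybridNE7_of_endpointLetters [DecidableEq ι] (hl₀ : 0 ≤ l₀) (hvol : 0 < vol)
    (hA : ∀ (K : ℕ) (t : ℝ), |t| ≤ l₀ → ∀ τ ∈ T K, 0 < A K t τ) (hB : ∀ (K : ℕ) (t : ℝ), |t| ≤ l₀ → ∀ τ ∈ T K, 0 < B K t τ)
    (hZA : ∀ (K : ℕ) (t : ℝ), |t| ≤ l₀ → 0 < ∑ τ ∈ T K, A K t τ) (hZB : ∀ (K : ℕ) (t : ℝ), |t| ≤ l₀ → 0 < ∑ τ ∈ T K, B K t τ)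
    {Z : ℕ → ℝ → ℝ} (hZA' : ∀ (K : ℕ) (t : ℝ), |t| ≤ l₀ → Z K t = ∑ τ ∈ T K, A K t τ)
    (hZB' : ∀ (K : ℕ) (t : ℝ), |t| ≤ l₀ → Z (K + 1) t = ∑ τ ∈ T K, B K t τ)
    {A' B' : ℕ → ℝ → ι → ℝ}
    (hdA : ∀ (K : ℕ) (s : ℝ), |s| ≤ l₀ → ∀ τ ∈ T K, HasDerivAt (fun u => A K u τ) (A' K s τ) s)
    (hdB : ∀ (K : ℕ) (s : ℝ), |s| ≤ l₀ → ∀ τ ∈ T K, HasDerivAt (fun u => B K u τ) (B' K s τ) s)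
    {η R₁ : ℕ → ℝ} {χ : ℝ} {m : ℕ → ℝ → ℝ}
    (hH : ∀ (K : ℕ) (t : ℝ), |t| ≤ l₀ →
      1 - ∑ τ ∈ T K, Real.sqrt ((A K t τ / ∑ σ ∈ T K, A K t σ) * (B K t τ / ∑ σ ∈ T K, B K t σ)) ≤ η K)
    (hη2 : ∀ K, η K < 1 / 2) (hηs : Summable fun K => Real.sqrt (η K))
    (hR : ∀ (K : ℕ) (s : ℝ), |s| ≤ l₀ →
      |∑ τ ∈ T K, B K s τ / (∑ σ ∈ T K, B K s σ) * (B' K s τ / B K s τ - A' K s τ / A K s τ)| ≤ R₁ K)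
    (hRs : Summable R₁)
    (hχ : ∀ (K : ℕ) (s : ℝ), |s| ≤ l₀ →
      ∑ τ ∈ T K, (A K s τ / (∑ σ ∈ T K, A K s σ) + B K s τ / (∑ σ ∈ T K, B K s σ)) / 2 * (A' K s τ / A K s τ - m K s) ^ 2 ≤ χ) :
    ∃ shA shB : ℕ → ℝ → ι → ℝ,
      HybridNE7 l₀ vol T A B (fun _ _ => ∅) (fun _ => 0) shA shB (fun K => Real.sqrt (2 * η K))
        (fun K => l₀ * (R₁ K + 2 * Real.sqrt (2 * η K) * Real.sqrt χ) / vol) := by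
  have hTgt := target_of_endpointResponse hl₀ hvol hA hB hZA hZB hZA' hZB' hdA hdB hH hR hχ hηs hRs
  have hs2 : Summable fun K => Real.sqrt (2 * η K) := by
    have : (fun K => Real.sqrt (2 * η K)) = fun K => Real.sqrt 2 * Real.sqrt (η K) := by
      funext K; exact Real.sqrt_mul (by norm_num) _
    rw [this]; exact hηs.mul_left _
  refine exists_hybridNE7_of_target_of_classLawTV hl₀ (fun K t ht τ hτ => (hA K t ht τ hτ).le) (fun K t ht τ hτ => (hB K t ht τ hτ).le)
    hZA hZB hZA' hZB' hTgt (fun K => Real.sqrt_nonneg _) (fun K => ?_) hs2 (classLawTV_of_affinityDefect hA hB hZA hZB hH)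
  rw [show (1:ℝ) = Real.sqrt 1 by simp]
  exact Real.sqrt_lt_sqrt (by linarith [eta_nonneg_of_affinityDefect hl₀ hA hB hZA hZB hH K]) (by linarith [hη2 K])

end Road

/-! ## §3 The (H)-suppliers of edition 2: mixture moment; one-run variances in the regime; wild mass + tame moment [folklore] -/

section Suppliers
variable {l₀ vol : ℝ} {T : ℕ → Finset ι} {A B : ℕ → ℝ → ι → ℝ}

/-- **★★ (M) ⇒ (H) with `η := M∕4`** [folklore]: the mixture second moment of the CENTRED two-run increment `h − c_{K,t}` (`h = log B − log A`, `c_{K,t} = log Z_B − log Z_A`)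
bounded by `M_K` on the window gives the affinity-defect letter with `η_K = M_K∕4` (FILE 1b `one_sub_affinity_classLaw_le_quarter_mixtureMoment` at each `(K, t)`). -/
theorem affinityDefect_of_mixtureMoment [DecidableEq ι]
    (hA : ∀ (K : ℕ) (t : ℝ), |t| ≤ l₀ → ∀ τ ∈ T K, 0 < A K t τ) (hB : ∀ (K : ℕ) (t : ℝ), |t| ≤ l₀ → ∀ τ ∈ T K, 0 < B K t τ)
    (hZA : ∀ (K : ℕ) (t : ℝ), |t| ≤ l₀ → 0 < ∑ τ ∈ T K, A K t τ) (hZB : ∀ (K : ℕ) (t : ℝ), |t| ≤ l₀ → 0 < ∑ τ ∈ T K, B K t τ)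
    {M : ℕ → ℝ}
    (hM : ∀ (K : ℕ) (t : ℝ), |t| ≤ l₀ →
      ∑ τ ∈ T K, (A K t τ / (∑ σ ∈ T K, A K t σ) + B K t τ / (∑ σ ∈ T K, B K t σ)) / 2
          * ((Real.log (B K t τ) - Real.log (A K t τ))
              - (Real.log (∑ σ ∈ T K, B K t σ) - Real.log (∑ σ ∈ T K, A K t σ))) ^ 2 ≤ M K) :
    ∀ (K : ℕ) (t : ℝ), |t| ≤ l₀ →
      1 - ∑ τ ∈ T K, Real.sqrt ((A K t τ / ∑ σ ∈ T K, A K t σ) * (B K t τ / ∑ σ ∈ T K, B K t σ)) ≤ M K / 4 :=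
  fun K t ht => (one_sub_affinity_classLaw_le_quarter_mixtureMoment (hA K t ht) (hB K t ht) (hZA K t ht) (hZB K t ht)).trans
    (by linarith [hM K t ht])

/-- **★★ THE ROAD FROM THE MIXTURE-MOMENT LETTER** [folklore]: (M) with `M_K < 2` and `Σ √M_K < ∞`, (R′), (R‑c), positivity, differentiability and the dictionary ⇒
`∃ shA shB, HybridNE7 l₀ vol T A B ∅ 0 shA shB (K ↦ √(2·(M_K∕4))) δ` — `exists_hybridNE7_of_endpointLetters` with `η := M∕4`.  NO regime hypothesis on this edition. -/
theorem exists_hybridNE7_of_mixtureMoment_and_response [DecidableEq ι] (hl₀ : 0 ≤ l₀) (hvol : 0 < vol)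
    (hA : ∀ (K : ℕ) (t : ℝ), |t| ≤ l₀ → ∀ τ ∈ T K, 0 < A K t τ) (hB : ∀ (K : ℕ) (t : ℝ), |t| ≤ l₀ → ∀ τ ∈ T K, 0 < B K t τ)
    (hZA : ∀ (K : ℕ) (t : ℝ), |t| ≤ l₀ → 0 < ∑ τ ∈ T K, A K t τ) (hZB : ∀ (K : ℕ) (t : ℝ), |t| ≤ l₀ → 0 < ∑ τ ∈ T K, B K t τ)
    {Z : ℕ → ℝ → ℝ} (hZA' : ∀ (K : ℕ) (t : ℝ), |t| ≤ l₀ → Z K t = ∑ τ ∈ T K, A K t τ)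
    (hZB' : ∀ (K : ℕ) (t : ℝ), |t| ≤ l₀ → Z (K + 1) t = ∑ τ ∈ T K, B K t τ)
    {A' B' : ℕ → ℝ → ι → ℝ}
    (hdA : ∀ (K : ℕ) (s : ℝ), |s| ≤ l₀ → ∀ τ ∈ T K, HasDerivAt (fun u => A K u τ) (A' K s τ) s)
    (hdB : ∀ (K : ℕ) (s : ℝ), |s| ≤ l₀ → ∀ τ ∈ T K, HasDerivAt (fun u => B K u τ) (B' K s τ) s)
    {M R₁ : ℕ → ℝ} {χ : ℝ} {m : ℕ → ℝ → ℝ}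
    (hM : ∀ (K : ℕ) (t : ℝ), |t| ≤ l₀ →
      ∑ τ ∈ T K, (A K t τ / (∑ σ ∈ T K, A K t σ) + B K t τ / (∑ σ ∈ T K, B K t σ)) / 2
          * ((Real.log (B K t τ) - Real.log (A K t τ))
              - (Real.log (∑ σ ∈ T K, B K t σ) - Real.log (∑ σ ∈ T K, A K t σ))) ^ 2 ≤ M K)
    (hM2 : ∀ K, M K < 2) (hMs : Summable fun K => Real.sqrt (M K))
    (hR : ∀ (K : ℕ) (s : ℝ), |s| ≤ l₀ →
      |∑ τ ∈ T K, B K s τ / (∑ σ ∈ T K, B K s σ) * (B' K s τ / B K s τ - A' K s τ / A K s τ)| ≤ R₁ K)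
    (hRs : Summable R₁)
    (hχ : ∀ (K : ℕ) (s : ℝ), |s| ≤ l₀ →
      ∑ τ ∈ T K, (A K s τ / (∑ σ ∈ T K, A K s σ) + B K s τ / (∑ σ ∈ T K, B K s σ)) / 2 * (A' K s τ / A K s τ - m K s) ^ 2 ≤ χ) :
    ∃ shA shB : ℕ → ℝ → ι → ℝ,
      HybridNE7 l₀ vol T A B (fun _ _ => ∅) (fun _ => 0) shA shB (fun K => Real.sqrt (2 * (M K / 4)))
        (fun K => l₀ * (R₁ K + 2 * Real.sqrt (2 * (M K / 4)) * Real.sqrt χ) / vol) := by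
  have hMs' : Summable fun K => Real.sqrt (M K / 4) := by
    have : (fun K => Real.sqrt (M K / 4)) = fun K => Real.sqrt (M K) * (Real.sqrt 4)⁻¹ := by
      funext K; rw [Real.sqrt_div' _ (by norm_num : (0:ℝ) ≤ 4), div_eq_mul_inv]
    rw [this]; exact hMs.mul_right _
  exact exists_hybridNE7_of_endpointLetters hl₀ hvol hA hB hZA hZB hZA' hZB' hdA hdB
    (affinityDefect_of_mixtureMoment hA hB hZA hZB hM) (fun K => by linarith [hM2 K]) hMs' hR hRs hχ

/-- **★ ONE-RUN VARIANCES IN THE REGIME ⇒ (H) with `η := V∕4`** [folklore]: the DISPLAYED a-priori regime `1 − Σ√(p_{K,t}q_{K,t}) ≤ 1∕16` and the two ONE-RUN variances of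
the two-run increment, `Var_{p_{K,t}} h + Var_{q_{K,t}} h ≤ V_K`, give the affinity-defect letter with `η_K = V_K∕4` (FILE 1b `mixtureMoment_logRatio_le_of_regime` — the
Gibbs–Bogoliubov sandwich certifies the centring — then `one_sub_affinity_classLaw_le_quarter_mixtureMoment`).  The regime cannot be dropped (dag-n20-w4 g2 (i)). -/
theorem affinityDefect_of_oneRunVariances_of_regime [DecidableEq ι]
    (hA : ∀ (K : ℕ) (t : ℝ), |t| ≤ l₀ → ∀ τ ∈ T K, 0 < A K t τ) (hB : ∀ (K : ℕ) (t : ℝ), |t| ≤ l₀ → ∀ τ ∈ T K, 0 < B K t τ)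
    (hZA : ∀ (K : ℕ) (t : ℝ), |t| ≤ l₀ → 0 < ∑ τ ∈ T K, A K t τ) (hZB : ∀ (K : ℕ) (t : ℝ), |t| ≤ l₀ → 0 < ∑ τ ∈ T K, B K t τ)
    (hreg : ∀ (K : ℕ) (t : ℝ), |t| ≤ l₀ →
      1 - ∑ τ ∈ T K, Real.sqrt ((A K t τ / ∑ σ ∈ T K, A K t σ) * (B K t τ / ∑ σ ∈ T K, B K t σ)) ≤ 1 / 16)
    {V : ℕ → ℝ}
    (hV : ∀ (K : ℕ) (t : ℝ), |t| ≤ l₀ →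
      (∑ τ ∈ T K, A K t τ / (∑ σ ∈ T K, A K t σ) * ((Real.log (B K t τ) - Real.log (A K t τ))
            - ∑ σ ∈ T K, A K t σ / (∑ σ' ∈ T K, A K t σ') * (Real.log (B K t σ) - Real.log (A K t σ))) ^ 2)
        + ∑ τ ∈ T K, B K t τ / (∑ σ ∈ T K, B K t σ) * ((Real.log (B K t τ) - Real.log (A K t τ))
            - ∑ σ ∈ T K, B K t σ / (∑ σ' ∈ T K, B K t σ') * (Real.log (B K t σ) - Real.log (A K t σ))) ^ 2 ≤ V K) :
    ∀ (K : ℕ) (t : ℝ), |t| ≤ l₀ →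
      1 - ∑ τ ∈ T K, Real.sqrt ((A K t τ / ∑ σ ∈ T K, A K t σ) * (B K t τ / ∑ σ ∈ T K, B K t σ)) ≤ V K / 4 := by
  intro K t ht
  have h1 := one_sub_affinity_classLaw_le_quarter_mixtureMoment (hA K t ht) (hB K t ht) (hZA K t ht) (hZB K t ht)
  have h2 := mixtureMoment_logRatio_le_of_regime (hA K t ht) (hB K t ht) (hZA K t ht) (hZB K t ht) (hreg K t ht)
  linarith [hV K t ht]

/-- **★ THE ROAD FROM TWO ONE-RUN VARIANCES IN THE REGIME** [folklore]: regime + `Var_p h + Var_q h ≤ V_K` (`V_K < 2`, `Σ √V_K < ∞`) + (R′) + (R‑c) + positivity,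
differentiability, dictionary ⇒ `∃ shA shB, HybridNE7 l₀ vol T A B ∅ 0 shA shB (K ↦ √(2·(V_K∕4))) δ` — `exists_hybridNE7_of_endpointLetters` with `η := V∕4`. -/
theorem exists_hybridNE7_of_oneRunVariances_of_regime [DecidableEq ι] (hl₀ : 0 ≤ l₀) (hvol : 0 < vol)
    (hA : ∀ (K : ℕ) (t : ℝ), |t| ≤ l₀ → ∀ τ ∈ T K, 0 < A K t τ) (hB : ∀ (K : ℕ) (t : ℝ), |t| ≤ l₀ → ∀ τ ∈ T K, 0 < B K t τ)
    (hZA : ∀ (K : ℕ) (t : ℝ), |t| ≤ l₀ → 0 < ∑ τ ∈ T K, A K t τ) (hZB : ∀ (K : ℕ) (t : ℝ), |t| ≤ l₀ → 0 < ∑ τ ∈ T K, B K t τ)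
    {Z : ℕ → ℝ → ℝ} (hZA' : ∀ (K : ℕ) (t : ℝ), |t| ≤ l₀ → Z K t = ∑ τ ∈ T K, A K t τ)
    (hZB' : ∀ (K : ℕ) (t : ℝ), |t| ≤ l₀ → Z (K + 1) t = ∑ τ ∈ T K, B K t τ)
    {A' B' : ℕ → ℝ → ι → ℝ}
    (hdA : ∀ (K : ℕ) (s : ℝ), |s| ≤ l₀ → ∀ τ ∈ T K, HasDerivAt (fun u => A K u τ) (A' K s τ) s)
    (hdB : ∀ (K : ℕ) (s : ℝ), |s| ≤ l₀ → ∀ τ ∈ T K, HasDerivAt (fun u => B K u τ) (B' K s τ) s)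
    (hreg : ∀ (K : ℕ) (t : ℝ), |t| ≤ l₀ →
      1 - ∑ τ ∈ T K, Real.sqrt ((A K t τ / ∑ σ ∈ T K, A K t σ) * (B K t τ / ∑ σ ∈ T K, B K t σ)) ≤ 1 / 16)
    {V R₁ : ℕ → ℝ} {χ : ℝ} {m : ℕ → ℝ → ℝ}
    (hV : ∀ (K : ℕ) (t : ℝ), |t| ≤ l₀ →
      (∑ τ ∈ T K, A K t τ / (∑ σ ∈ T K, A K t σ) * ((Real.log (B K t τ) - Real.log (A K t τ))
            - ∑ σ ∈ T K, A K t σ / (∑ σ' ∈ T K, A K t σ') * (Real.log (B K t σ) - Real.log (A K t σ))) ^ 2)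
        + ∑ τ ∈ T K, B K t τ / (∑ σ ∈ T K, B K t σ) * ((Real.log (B K t τ) - Real.log (A K t τ))
            - ∑ σ ∈ T K, B K t σ / (∑ σ' ∈ T K, B K t σ') * (Real.log (B K t σ) - Real.log (A K t σ))) ^ 2 ≤ V K)
    (hV2 : ∀ K, V K < 2) (hVs : Summable fun K => Real.sqrt (V K))
    (hR : ∀ (K : ℕ) (s : ℝ), |s| ≤ l₀ →
      |∑ τ ∈ T K, B K s τ / (∑ σ ∈ T K, B K s σ) * (B' K s τ / B K s τ - A' K s τ / A K s τ)| ≤ R₁ K)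
    (hRs : Summable R₁)
    (hχ : ∀ (K : ℕ) (s : ℝ), |s| ≤ l₀ →
      ∑ τ ∈ T K, (A K s τ / (∑ σ ∈ T K, A K s σ) + B K s τ / (∑ σ ∈ T K, B K s σ)) / 2 * (A' K s τ / A K s τ - m K s) ^ 2 ≤ χ) :
    ∃ shA shB : ℕ → ℝ → ι → ℝ,
      HybridNE7 l₀ vol T A B (fun _ _ => ∅) (fun _ => 0) shA shB (fun K => Real.sqrt (2 * (V K / 4)))
        (fun K => l₀ * (R₁ K + 2 * Real.sqrt (2 * (V K / 4)) * Real.sqrt χ) / vol) := by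
  have hVs' : Summable fun K => Real.sqrt (V K / 4) := by
    have : (fun K => Real.sqrt (V K / 4)) = fun K => Real.sqrt (V K) * (Real.sqrt 4)⁻¹ := by
      funext K; rw [Real.sqrt_div' _ (by norm_num : (0:ℝ) ≤ 4), div_eq_mul_inv]
    rw [this]; exact hVs.mul_right _
  exact exists_hybridNE7_of_endpointLetters hl₀ hvol hA hB hZA hZB hZA' hZB' hdA hdB
    (affinityDefect_of_oneRunVariances_of_regime hA hB hZA hZB hreg hV) (fun K => by linarith [hV2 K]) hVs' hR hRs hχ

/-- **★ WILD MASS + TAME MOMENT ⇒ (H) with `η := w + M∕4`** [folklore; the card's (V‑a) + (V‑c′) split]: wild sets `W K t ⊆ T K` with wild MASS `½·Σ_W (p + q) ≤ w_K` under the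
two runs' own laws and the TAME mixture moment of the centred increment `Σ_{T∖W} ½(p+q)(h − c)² ≤ M_K` give the affinity-defect letter with `η_K = w_K + M_K∕4`
(FILE 1b `one_sub_affinity_classLaw_le_wildMass_add_mixtureMoment`) — feed it to `exists_hybridNE7_of_endpointLetters`. -/
theorem affinityDefect_of_wildMass_and_tameMoment [DecidableEq ι]
    (hA : ∀ (K : ℕ) (t : ℝ), |t| ≤ l₀ → ∀ τ ∈ T K, 0 < A K t τ) (hB : ∀ (K : ℕ) (t : ℝ), |t| ≤ l₀ → ∀ τ ∈ T K, 0 < B K t τ)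
    (hZA : ∀ (K : ℕ) (t : ℝ), |t| ≤ l₀ → 0 < ∑ τ ∈ T K, A K t τ) (hZB : ∀ (K : ℕ) (t : ℝ), |t| ≤ l₀ → 0 < ∑ τ ∈ T K, B K t τ)
    {W : ℕ → ℝ → Finset ι} (hW : ∀ (K : ℕ) (t : ℝ), |t| ≤ l₀ → W K t ⊆ T K)
    {w M : ℕ → ℝ}
    (hw : ∀ (K : ℕ) (t : ℝ), |t| ≤ l₀ →
      (∑ τ ∈ W K t, (A K t τ / (∑ σ ∈ T K, A K t σ) + B K t τ / (∑ σ ∈ T K, B K t σ))) / 2 ≤ w K)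
    (hM : ∀ (K : ℕ) (t : ℝ), |t| ≤ l₀ →
      ∑ τ ∈ T K \ W K t, (A K t τ / (∑ σ ∈ T K, A K t σ) + B K t τ / (∑ σ ∈ T K, B K t σ)) / 2
          * ((Real.log (B K t τ) - Real.log (A K t τ))
              - (Real.log (∑ σ ∈ T K, B K t σ) - Real.log (∑ σ ∈ T K, A K t σ))) ^ 2 ≤ M K) :
    ∀ (K : ℕ) (t : ℝ), |t| ≤ l₀ →
      1 - ∑ τ ∈ T K, Real.sqrt ((A K t τ / ∑ σ ∈ T K, A K t σ) * (B K t τ / ∑ σ ∈ T K, B K t σ)) ≤ w K + M K / 4 := by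
  intro K t ht
  have h := one_sub_affinity_classLaw_le_wildMass_add_mixtureMoment (hA K t ht) (hB K t ht) (hZA K t ht) (hZB K t ht) (hW K t ht)
  linarith [hw K t ht, hM K t ht]

end Suppliers

end Summit.QuantumFields.YangMills.BalabanUVNodes.N20HellingerEndpointRoad
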